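import Mathlib
import Summits.Parity.BatemanHorn.Theorems.IsogenyRedeiTypeIMainTermMoebiusDensity
import HarnessLib

/-!
# Type-I main term for Bateman–Horn (stmt-Parity-0873), input B4 (part 1):
# the one-dimensional inputs in log-rate form

For each member `f_i` of the system, the real arithmetic functions
`mg f i = μ · g_i` and `mgl f i = μ · g_i · log` (`g_i = rootDensity (f i)`) satisfy, for every
`A : ℕ`, the log-rate package of `…Hyperbola.lean`:
`|∑_{n ≤ N} mg_i(n)| ≤ K/(1 + log N)^A`, `|∑_{n ≤ N} mgl_i(n) + C(f_i)| ≤ K/(1 + log N)^A`,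
`∑_{n ≤ N} |mg_i(n)|, ∑_{n ≤ N} |mgl_i(n)| ≤ M (1 + log N)²` (`N ≥ 1`), from
`moebius_rootDensity_sums` (rate `e^{−c√log x}`, `exp_neg_sqrt_log_le`) and Hall–Tenenbaum
(`HallTenenbaum.sum_div_le_exp_of_le` with `exists_sum_primesLE_rootCount_div_le`).
Everything here is proved.
-/

noncomputable section

open Finset Polynomial ArithmeticFunction
open scoped ArithmeticFunction.Moebius

namespace Summit.Parity.BatemanHorn.Theorems.TypeIMainTerm

open Literature.NumberTheory.Sieve Literature.NumberTheory.LFunctions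

variable {k : ℕ} (f : Fin k → ℤ[X])

/-- `Ioc 0 N = Icc 1 ⌊(N : ℝ)⌋₊`. -/
theorem Ioc_zero_eq_Icc_one_floor (N : ℕ) : Finset.Ioc 0 N = Finset.Icc 1 ⌊(N : ℝ)⌋₊ := by
  rw [Nat.floor_natCast]; ext n; simp only [Finset.mem_Ioc, Finset.mem_Icc]; omega

/-- `e^{−c√log x} ≤ C'/(1 + log x)^A` for `x ≥ 1`. -/
theorem exp_neg_sqrt_log_le {c : ℝ} (hc : 0 < c) (A : ℕ) :
    ∃ C' : ℝ, 0 ≤ C' ∧ ∀ x : ℝ, 1 ≤ x →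
      Real.exp (-c * Real.sqrt (Real.log x)) ≤ C' / (1 + Real.log x) ^ A := by
  set D : ℝ := (2 : ℝ) ^ A * (1 + (Nat.factorial (2 * A) : ℝ) / c ^ (2 * A)) with hD
  refine ⟨D, by positivity, fun x hx => ?_⟩
  have hL : 0 ≤ Real.log x := Real.log_nonneg hx
  set u : ℝ := Real.sqrt (Real.log x) with hu
  have hu0 : 0 ≤ u := Real.sqrt_nonneg _
  have huL : u ^ 2 = Real.log x := Real.sq_sqrt hL
  rw [le_div_iff₀ (by positivity), ← huL]
  -- `e^{-cu} (1 + u²)^A ≤ D`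
  rcases le_or_gt u 1 with hu1 | hu1
  · have h1 : (1 + u ^ 2) ^ A ≤ (2 : ℝ) ^ A := pow_le_pow_left₀ (by positivity) (by nlinarith) A
    have h2 : Real.exp (-c * u) ≤ 1 := Real.exp_le_one_iff.mpr (by nlinarith)
    calc Real.exp (-c * u) * (1 + u ^ 2) ^ A ≤ 1 * (2 : ℝ) ^ A :=
          mul_le_mul h2 h1 (by positivity) zero_le_one
      _ ≤ D := by
          rw [one_mul, hD]
          exact le_mul_of_one_le_right (by positivity) (by
            have : 0 ≤ (Nat.factorial (2 * A) : ℝ) / c ^ (2 * A) := by positivity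
            linarith)
  · -- `e^{cu} ≥ (cu)^{2A}/(2A)!`
    have hcu : 0 ≤ c * u := by positivity
    have h3 := Real.pow_div_factorial_le_exp (c * u) hcu (2 * A)
    have hfac : (0 : ℝ) < Nat.factorial (2 * A) := by exact_mod_cast Nat.factorial_pos _
    have hcpow : 0 < c ^ (2 * A) := pow_pos hc _
    have hupow : 0 < u ^ (2 * A) := pow_pos (by linarith) _
    have h4 : Real.exp (-c * u) ≤ Nat.factorial (2 * A) / (c * u) ^ (2 * A) := by
      rw [neg_mul, Real.exp_neg, inv_eq_one_div, div_le_div_iff₀ (Real.exp_pos _) (by positivity),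
        one_mul]
      rw [div_le_iff₀ hfac] at h3
      linarith
    have h5 : (1 + u ^ 2) ^ A ≤ (2 : ℝ) ^ A * u ^ (2 * A) := by
      rw [pow_mul, ← mul_pow]
      exact pow_le_pow_left₀ (by positivity) (by nlinarith) A
    calc Real.exp (-c * u) * (1 + u ^ 2) ^ A
        ≤ (Nat.factorial (2 * A) / (c * u) ^ (2 * A)) * ((2 : ℝ) ^ A * u ^ (2 * A)) :=
          mul_le_mul h4 h5 (by positivity) (by positivity)
      _ = (2 : ℝ) ^ A * ((Nat.factorial (2 * A) : ℝ) / c ^ (2 * A)) := by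
          rw [mul_pow]; field_simp
      _ ≤ D := by rw [hD]; nlinarith [pow_pos (two_pos : (0:ℝ) < 2) A]

/-- **The rates of `mg_i` and `mgl_i` in log-power form.** -/
theorem mg_mgl_rate (hirr : ∀ i, Irreducible (f i)) (hdeg : ∀ i, 1 ≤ (f i).natDegree)
    (hlc : ∀ i, 0 < (f i).leadingCoeff) (hρ : ∀ i p, p.Prime → polyRootCountMod ![f i] p < p)
    (A : ℕ) :
    ∃ K : ℝ, 0 ≤ K ∧ ∀ i,
      (∀ N : ℕ, 1 ≤ N → |∑ n ∈ Ioc 0 N, mg f i n - 0| ≤ K / (1 + Real.log N) ^ A) ∧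
      (∀ N : ℕ, 1 ≤ N → |∑ n ∈ Ioc 0 N, mgl f i n - (-batemanHornConst ![f i])| ≤
        K / (1 + Real.log N) ^ A) := by
  have key : ∀ i, ∃ K : ℝ, 0 ≤ K ∧
      (∀ N : ℕ, 1 ≤ N → |∑ n ∈ Ioc 0 N, mg f i n - 0| ≤ K / (1 + Real.log N) ^ A) ∧
      (∀ N : ℕ, 1 ≤ N → |∑ n ∈ Ioc 0 N, mgl f i n - (-batemanHornConst ![f i])| ≤
        K / (1 + Real.log N) ^ A) := by
    intro i
    obtain ⟨-, c, C, hc, hC, hS, hR⟩ := moebius_rootDensity_sums (hirr i) (hdeg i) (hlc i) (hρ i)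
    obtain ⟨C', hC', hexp⟩ := exp_neg_sqrt_log_le hc A
    refine ⟨C * C', by positivity, fun N hN => ?_, fun N hN => ?_⟩
    · have hN1 : (1 : ℝ) ≤ N := by exact_mod_cast hN
      rw [sub_zero, Ioc_zero_eq_Icc_one_floor]
      refine (hS N hN1).trans ?_
      rw [mul_div_assoc]
      exact mul_le_mul_of_nonneg_left (hexp N hN1) hC
    · have hN1 : (1 : ℝ) ≤ N := by exact_mod_cast hN
      rw [sub_neg_eq_add, Ioc_zero_eq_Icc_one_floor]
      refine (hR N hN1).trans ?_
      rw [mul_div_assoc]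
      exact mul_le_mul_of_nonneg_left (hexp N hN1) hC
  choose K hK0 hK using key
  refine ⟨∑ i, K i, Finset.sum_nonneg fun i _ => hK0 i, fun i => ⟨fun N hN => ?_, fun N hN => ?_⟩⟩
  · refine ((hK i).1 N hN).trans (div_le_div_of_nonneg_right ?_ (by
      have := Real.log_nonneg (show (1:ℝ) ≤ N by exact_mod_cast hN); positivity))
    exact Finset.single_le_sum (fun j _ => hK0 j) (Finset.mem_univ i)
  · refine ((hK i).2 N hN).trans (div_le_div_of_nonneg_right ?_ (by
      have := Real.log_nonneg (show (1:ℝ) ≤ N by exact_mod_cast hN); positivity))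
    exact Finset.single_le_sum (fun j _ => hK0 j) (Finset.mem_univ i)

/-- **The variation of `mg_i`, `mgl_i`**: `∑_{n ≤ N} |mg_i(n)|, ∑_{n ≤ N} |mgl_i(n)| ≤ M (1 + log N)²`. -/
theorem mg_mgl_variation (hirr : ∀ i, Irreducible (f i)) (hdeg : ∀ i, 1 ≤ (f i).natDegree) :
    ∃ M : ℝ, 1 ≤ M ∧ ∀ i,
      (∀ N : ℕ, 1 ≤ N → ∑ n ∈ Ioc 0 N, |mg f i n| ≤ M * (1 + Real.log N) ^ 2) ∧
      (∀ N : ℕ, 1 ≤ N → ∑ n ∈ Ioc 0 N, |mgl f i n| ≤ M * (1 + Real.log N) ^ 2) := by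
  have key : ∀ i, ∃ M : ℝ, 1 ≤ M ∧ ∀ N : ℕ, 1 ≤ N → ∑ n ∈ Ioc 0 N, |mg f i n| ≤ M * (1 + Real.log N) := by
    intro i
    obtain ⟨B, hB1, hB⟩ := exists_rootCount_prime_le (hirr i).ne_zero
    obtain ⟨Cf, hCf⟩ := exists_sum_primesLE_rootCount_div_le (hirr i) (hdeg i)
    -- `F(n) = μ(n)² ρ_i(n)` is multiplicative, `F(p^ν) ≤ B`
    set F : ℕ → ℝ := fun n => (μ n : ℝ) ^ 2 * (polyRootCountMod ![f i] n : ℝ) with hF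
    have hF1 : F 1 = 1 := by simp [hF, polyRootCountMod_one]
    have hFmul : ∀ m n, Nat.Coprime m n → F (m * n) = F m * F n := by
      intro m n hmn; simp only [hF]
      rw [ArithmeticFunction.isMultiplicative_moebius.map_mul_of_coprime hmn,
        polyRootCountMod_mul_of_coprime _ hmn]; push_cast; ring
    have hF0 : ∀ n, 0 ≤ F n := fun n => by positivity
    have hFK : ∀ p : ℕ, p.Prime → ∀ ν : ℕ, 1 ≤ ν → F (p ^ ν) ≤ B := by
      intro p hp ν hν; simp only [hF]
      rcases Nat.lt_or_ge ν 2 with h2 | h2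
      · have : ν = 1 := by omega
        subst this; rw [pow_one, ArithmeticFunction.moebius_apply_prime hp]; push_cast
        nlinarith [hB p hp]
      · rw [ArithmeticFunction.moebius_apply_prime_pow hp (by omega), if_neg (by omega)]
        simp only [Int.cast_zero, ne_eq, OfNat.ofNat_ne_zero, not_false_eq_true, zero_pow, zero_mul]
        linarith
    set M : ℝ := Real.exp (B + |Cf| + B) with hM
    refine ⟨M, by rw [hM]; exact Real.one_le_exp (by positivity), fun N hN => ?_⟩
    have hHT := HallTenenbaum.sum_div_le_exp_of_le hF1 hFmul hF0 hB1 hFK N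
    have hlhs : ∑ n ∈ Ioc 0 N, |mg f i n| = ∑ n ∈ Icc 1 N, F n / n := by
      rw [show Finset.Ioc 0 N = Finset.Icc 1 N by ext n; simp only [Finset.mem_Ioc, Finset.mem_Icc]; omega]
      refine Finset.sum_congr rfl fun n _ => ?_
      rw [mg_apply, abs_mul, abs_of_nonneg (rootDensity_nonneg _ _), rootDensity_apply]
      simp only [hF]
      rw [mul_div_assoc]
      congr 1
      rcases ArithmeticFunction.moebius_eq_or n with h | h | h <;> simp [h]
    rw [hlhs]
    refine hHT.trans ?_
    -- `∑_{p ≤ N} F(p)/p = ∑_{p ≤ N} ρ_i(p)/p ≤ log log N + Cf` (for `N ≥ 2`)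
    have hFp : ∀ p ∈ Nat.primesLE N, F p / p = (polyRootCountMod ![f i] p : ℝ) / p := by
      intro p hp; simp only [hF]
      rw [ArithmeticFunction.moebius_apply_prime (Nat.prime_of_mem_primesLE hp)]; push_cast; ring
    rw [Finset.sum_congr rfl hFp]
    have hlogN : 0 ≤ Real.log N := Real.log_nonneg (by exact_mod_cast hN)
    rcases Nat.lt_or_ge N 2 with hN2 | hN2
    · have hN1 : N = 1 := by omega
      subst hN1
      have : Nat.primesLE 1 = ∅ := by
        ext p; simp only [Nat.mem_primesLE, Finset.notMem_empty, iff_false, not_and]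
        intro hp hpp; exact absurd hp (by have := hpp.two_le; omega)
      rw [this, Finset.sum_empty, add_zero, Nat.cast_one, Real.log_one, add_zero, mul_one, hM]
      exact Real.exp_le_exp.mpr (by have := abs_nonneg Cf; linarith)
    · have h2 := hCf N hN2
      have hlogpos : 0 < Real.log N := Real.log_pos (by exact_mod_cast hN2)
      calc Real.exp (B + ∑ p ∈ Nat.primesLE N, (polyRootCountMod ![f i] p : ℝ) / p)
          ≤ Real.exp (B + (Real.log (Real.log N) + |Cf|)) :=
            Real.exp_le_exp.mpr (by linarith [le_abs_self Cf])
        _ = Real.exp (B + |Cf|) * Real.log N := by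
            rw [show B + (Real.log (Real.log N) + |Cf|) = (B + |Cf|) + Real.log (Real.log N) by ring,
              Real.exp_add, Real.exp_log hlogpos]
        _ ≤ M * (1 + Real.log N) := by
            exact mul_le_mul (Real.exp_le_exp.mpr (by linarith)) (by linarith) hlogN (by positivity)
  choose M hM1 hM using key
  refine ⟨∑ i, M i + 1, by
    have : 0 ≤ ∑ i, M i := Finset.sum_nonneg fun i _ => by linarith [hM1 i]
    linarith, fun i => ?_⟩
  have hMi : M i ≤ ∑ j, M j + 1 := by
    have := Finset.single_le_sum (fun j _ => by linarith [hM1 j]) (Finset.mem_univ i) (f := M)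
    linarith
  have hbase : ∀ N : ℕ, 1 ≤ N → ∑ n ∈ Ioc 0 N, |mg f i n| ≤ (∑ j, M j + 1) * (1 + Real.log N) ^ 2 := by
    intro N hN
    have hℓ : 1 ≤ 1 + Real.log N := by
      have := Real.log_nonneg (show (1:ℝ) ≤ N by exact_mod_cast hN); linarith
    calc ∑ n ∈ Ioc 0 N, |mg f i n| ≤ M i * (1 + Real.log N) := hM i N hN
      _ ≤ (∑ j, M j + 1) * (1 + Real.log N) ^ 2 := by
          rw [pow_two]
          refine mul_le_mul hMi (le_mul_of_one_le_left (by linarith) hℓ) (by linarith) ?_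
          have : 0 ≤ ∑ j, M j := Finset.sum_nonneg fun j _ => by linarith [hM1 j]
          linarith
  refine ⟨hbase, fun N hN => ?_⟩
  have hℓ : 1 ≤ 1 + Real.log N := by
    have := Real.log_nonneg (show (1:ℝ) ≤ N by exact_mod_cast hN); linarith
  calc ∑ n ∈ Ioc 0 N, |mgl f i n| ≤ ∑ n ∈ Ioc 0 N, |mg f i n| * Real.log N := by
        refine Finset.sum_le_sum fun n hn => ?_
        obtain ⟨hn0, hnN⟩ := Finset.mem_Ioc.mp hn
        rw [mgl_apply, mg_apply, abs_mul]
        refine mul_le_mul_of_nonneg_left ?_ (abs_nonneg _)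
        rw [abs_of_nonneg (Real.log_nonneg (by exact_mod_cast hn0))]
        exact Real.log_le_log (by exact_mod_cast hn0) (by exact_mod_cast hnN)
    _ = (∑ n ∈ Ioc 0 N, |mg f i n|) * Real.log N := (Finset.sum_mul _ _ _).symm
    _ ≤ (M i * (1 + Real.log N)) * (1 + Real.log N) :=
        mul_le_mul (hM i N hN) (by linarith) (Real.log_nonneg (by exact_mod_cast hN))
          (by have := hM1 i; positivity)
    _ ≤ (∑ j, M j + 1) * (1 + Real.log N) ^ 2 := by
        rw [pow_two, ← mul_assoc]
        exact mul_le_mul_of_nonneg_right (mul_le_mul_of_nonneg_right hMi (by linarith)) (by linarith)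

end Summit.Parity.BatemanHorn.Theorems.TypeIMainTerm

end
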